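import Summits.BirchSwinnertonDyer.BirchSwinnertonDyer.Theorems.GenusKolyvaginAtTwoEquivariantKolyvaginExactAtTwoGorensteinPairing

/-!
# Route `GenusKolyvaginAtTwo`, LINE 6, KEY crux Q3 `EquivariantKolyvaginExactAtTwo`
# (stmt-BirchSwinnertonDyer-24882): DESCENT TO `ℚ` AT `p = 2` ON `Δ(E) < 0` — the algebra
# (helper, PROVED; seat `bsd-line-gk2-p3` g9, cell `bsd-f1-sign2`; sequel to `…GorensteinPairing`)

Companion of this seat's architecture memo `Q3-ARCH-v1.md` (evidence on item 24882). Its finding: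
McCallum's §5 (Kolyvagin's structure theorem, printed for `p` odd with `±`-eigenspaces) run
"`R_M`-linearly over `K`" at `2` LOSES one bit per `ℚ`-rational constituent of `Ш(E/K)` — the factor
`[K:ℚ] = 2` in `⟨res a, res b⟩_K = 2⟨a, b⟩_ℚ`, kernel form `Gorenstein.pairing_norm_norm` — whereas
run OVER `ℚ` (for `E` and its twist `E^K` separately, Kolyvagin's eigen classes `c_M(n)`,
`τc = ε_n c`, being classes over `ℚ`) it transposes VERBATIM, because on `Δ(E) < 0` the module
`E[2^M]` is free of rank one over `ℤ/2^M[C₂]` (item Q1, PROVED) and therefore: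

* §5 `C₂`-cohomologically trivial: `ker N = im N′` and `ker N′ = im N` (`N = 1 + τ`, `N′ = 1 − τ`),
  i.e. `H¹(C₂, E[2^M]) = Ĥ⁰(C₂, E[2^M]) = 0` for `C₂ = Gal(ℂ/ℝ)`, `Gal(K_λ/ℚ_ℓ)` (`ℓ` a Kolyvagin
  prime, `Frob_ℓ = τ` on `E[2^M]`) or `Gal(K/ℚ)`: no archimedean condition at `2`, restriction
  `H¹(ℚ_ℓ, E[2^M]) → H¹(K_λ, E[2^M])` injective (Q2's `λ`-orders and Q5′'s `λ`-prescriptions are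
  `ℚ_ℓ`-statements), and with `E(K)[2] = 0` inf-res identifies `H¹(ℚ, E[2^M])`, `H¹(ℚ, E^K[2^M])`
  with the `τ = ±1` parts of `H¹(K, E[2^M])`;
* §6 local CYCLICITY over `ℚ_ℓ`: for an abelian group `T` with an additive endomorphism `F` such that
  `T[2]` is free of rank one over `𝔽₂[F]`, the `F`-fixed (resp. anti-fixed) `2`-power torsion is
  CYCLIC (any two elements comparable under divisibility) — with `T = E(K_λ)[2^∞] = Ẽ(𝔽_{ℓ²})[2^∞]`,
  `F = Frob_ℓ`: `E(ℚ_ℓ)[2^∞] = Ẽ(𝔽_ℓ)[2^∞]` and `E^K(ℚ_ℓ)[2^∞]` are cyclic (of orders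
  `2^{v₂(ℓ+1∓a_ℓ)} ≥ 2^M`) at EVERY Kolyvagin prime of level `≥ M`, so McCallum's Lemma 5.3
  *"a duality of cyclic groups of order `p^M`"* holds over `ℚ_ℓ` at `2` as printed — while over `K_λ`
  the module `E(K_λ)/2^M` is `R_M`-free only at the strict primes `v₂(a_ℓ) > v₂(ℓ+1)`.

Pure algebra, sorry-free, std axioms; no number theory is used and BSD is not proved by any of this.
Helper for 24882 (`--supports … --as helper`); Q3 is not closed by this file.

References: [McCallumLMS1991] §3 (restriction to `L = K(E_{p^M})`), §5 Lemma 5.3, Thm. 5.4;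
[GrossLMS1991] §4 (no `K_n`-rational `p`-torsion), Prop. 4.4's proof in McCallum §4 (cyclic
eigenspaces of `E(𝔽_λ)`); V. A. Kolyvagin, *On the structure of Shafarevich–Tate groups* (LNM 1479,
1991; cite only): the structure theorem over `ℚ` for `E` and `E^D` separately.
-/

set_option autoImplicit false
set_option linter.dupNamespace false -- tree convention: `Summit.BirchSwinnertonDyer.BirchSwinnertonDyer.Theorems` (summit = sub-problem)

namespace Summit.BirchSwinnertonDyer.BirchSwinnertonDyer.Theorems.GenusExact.Gorenstein

/-! ### §5 Descent: a free rank-one `R_M`-module is `C₂`-cohomologically trivial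

Kernel form of "McCallum §5 should be run OVER ℚ at `2`" (this seat's memo `Q3-ARCH-v1.md`, evidence
on item 24882): for `A = E[2^M]` free of rank one over `ℤ/2^M[τ]` (Q1), both Tate cohomology groups of
`C₂ = ⟨τ⟩` vanish — `ker N = im N′` (`H¹ = 0`) and `ker N′ = im N` (`Ĥ⁰ = 0`). With `τ` = complex
conjugation this is `H¹(ℝ, E[2^M]) = 0` (no archimedean condition at `2` on `Δ < 0`); with
`τ` = `Frob_ℓ` at a Kolyvagin prime it is `H¹(K_λ/ℚ_ℓ, E[2^M]) = 0`, i.e. restriction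
`H¹(ℚ_ℓ, E[2^M]) → H¹(K_λ, E[2^M])` is injective, so local orders at `λ` (Q2) and local prescriptions at
`λ` (Q5′) are statements over `ℚ_ℓ`; with `τ ∈ Gal(K/ℚ)` and inf-res it is
`H¹(ℚ, E[2^M]) ≅ H¹(K, E[2^M])^{τ = 1}` given `E(K)[2] = 0`. -/

section Descent

variable {A : Type*} [AddCommGroup A] (τA : A →+ A) {M : ℕ} {P : A}

/-- **`ker N = N′·(ℤP)` in a free rank-one `R_M`-module:** `a + τa = 0 ↔ a = x(P − τP)` for some `x`.
[cite: McCallumLMS1991, §3 (τ acts with both eigenvalues on E_{p^M})] -/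
theorem norm_eq_zero_iff_of_free (hA : ∀ a, τA (τA a) = a) (hPM : (2 : ℤ) ^ M • P = 0)
    (hgen : ∀ a, ∃ x y : ℤ, a = x • P + y • τA P)
    (hfree : ∀ x y : ℤ, x • P + y • τA P = 0 → (2 : ℤ) ^ M ∣ x ∧ (2 : ℤ) ^ M ∣ y) (a : A) :
    a + τA a = 0 ↔ ∃ x : ℤ, a = x • (P - τA P) := by
  rw [← tau_eq_neg_iff_of_free τA hA hPM hgen hfree a, add_comm, add_eq_zero_iff_eq_neg]

/-- **`ker N′ = N·(ℤP)`:** `a − τa = 0 ↔ a = x(P + τP)` for some `x`.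
[cite: McCallumLMS1991, §3 (τ acts with both eigenvalues on E_{p^M})] -/
theorem conorm_eq_zero_iff_of_free (hA : ∀ a, τA (τA a) = a) (hPM : (2 : ℤ) ^ M • P = 0)
    (hgen : ∀ a, ∃ x y : ℤ, a = x • P + y • τA P)
    (hfree : ∀ x y : ℤ, x • P + y • τA P = 0 → (2 : ℤ) ^ M ∣ x ∧ (2 : ℤ) ^ M ∣ y) (a : A) :
    a - τA a = 0 ↔ ∃ x : ℤ, a = x • (P + τA P) := by
  rw [← tau_eq_self_iff_of_free τA hA hPM hgen hfree a, sub_eq_zero, eq_comm]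

/-- **`H¹(C₂, A) = 0` for `A` free of rank one over `R_M`:** every `a` with `Na = a + τa = 0` is a
`τ`-coboundary, `a = b − τb`. Reading: `H¹(ℝ, E[2^M]) = 0` and `H¹(Gal(K_λ/ℚ_ℓ), E[2^M]) = 0` on
`Δ(E) < 0` — the `p = 2` descent to `ℚ` of McCallum's argument costs no archimedean or quadratic-local
condition. [cite: McCallumLMS1991, §3 (restriction H¹(K,E_{p^M}) → H¹(L,E_{p^M}) injective)] -/
theorem exists_eq_sub_tau_of_norm_eq_zero (hA : ∀ a, τA (τA a) = a) (hPM : (2 : ℤ) ^ M • P = 0)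
    (hgen : ∀ a, ∃ x y : ℤ, a = x • P + y • τA P)
    (hfree : ∀ x y : ℤ, x • P + y • τA P = 0 → (2 : ℤ) ^ M ∣ x ∧ (2 : ℤ) ^ M ∣ y) {a : A}
    (ha : a + τA a = 0) : ∃ b : A, a = b - τA b := by
  obtain ⟨x, rfl⟩ := (norm_eq_zero_iff_of_free τA hA hPM hgen hfree a).mp ha
  exact ⟨x • P, by rw [smul_sub, map_zsmul]⟩

/-- **`Ĥ⁰(C₂, A) = 0` for `A` free of rank one over `R_M`:** every `τ`-invariant `a` is a norm,
`a = b + τb`. Reading: combined with `E(K)[2] = 0`, inf-res gives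
`H¹(ℚ, E[2^M]) ≅ H¹(K, E[2^M])^{τ=1}` and `H¹(ℚ, E^K[2^M]) ≅ H¹(K, E[2^M])^{τ=−1}` — Kolyvagin's
eigen classes `c_M(n)` (`τc = ε_n c`) live over `ℚ`. [cite: McCallumLMS1991, §5 (c_M(n) ∈ H¹(K,E_{p^M})^{ε_r})] -/
theorem exists_eq_add_tau_of_tau_eq_self (hA : ∀ a, τA (τA a) = a) (hPM : (2 : ℤ) ^ M • P = 0)
    (hgen : ∀ a, ∃ x y : ℤ, a = x • P + y • τA P)
    (hfree : ∀ x y : ℤ, x • P + y • τA P = 0 → (2 : ℤ) ^ M ∣ x ∧ (2 : ℤ) ^ M ∣ y) {a : A}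
    (ha : τA a = a) : ∃ b : A, a = b + τA b := by
  obtain ⟨x, rfl⟩ := (tau_eq_self_iff_of_free τA hA hPM hgen hfree a).mp ha
  exact ⟨x • P, by rw [smul_add, map_zsmul]⟩

end Descent

/-! ### §6 Local cyclicity over `ℚ_ℓ`: the invariants of a module whose `2`-torsion is free are cyclic

At a Kolyvagin prime `ℓ` of level `≥ M` (inert in `K`, `Frob_ℓ = τ` on `E[2^M]`), `T_λ := E(K_λ)[2^∞]
= Ẽ(𝔽_{ℓ²})[2^∞]` carries the involution `F = Frob_ℓ`, and `T_λ[2] = E[2]` is free of rank one over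
`𝔽₂[F]` (Q1 mod 2: `F` is a transposition on `E[2]` since `Δ < 0`). This § proves, as pure algebra,
that then the `F`-FIXED `2`-power torsion — `E(ℚ_ℓ)[2^∞] = Ẽ(𝔽_ℓ)[2^∞]` — is CYCLIC (any two
elements are comparable under divisibility), and likewise the anti-fixed part
(`E^K(ℚ_ℓ)[2^∞]`): McCallum's Lemma 5.3 "duality of CYCLIC groups of order `p^M`" holds over `ℚ_ℓ`
at `2` at every Kolyvagin prime, whereas over `K_λ` the module `E(K_λ)/2^M` is `R_M`-free only at the
strict primes `v₂(a_ℓ) > v₂(ℓ+1)`. -/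

section Cyclic

open scoped Classical

variable {T : Type*} [AddCommGroup T] (F : T →+ T)

/-- **Uniqueness of the fixed involution.** If `T[2] = {xP + yFP}` is free of rank one over
`𝔽₂[F]` (`xP + yFP = 0 ⟹ 2 ∣ x, y`, `F²P = P`, `2P = 0`), then the only `F`-fixed elements of
`T[2]` are `0` and `P + FP`: two non-zero `F`-fixed `2`-torsion elements are EQUAL.
[cite: McCallumLMS1991, §4 (proof of Prop. 4.4: the eigenspaces of E(F_λ) are cyclic)] -/
theorem eq_of_fixed_two_torsion {P : T} (hFP : F (F P) = P) (h2P : (2 : ℤ) • P = 0)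
    (hgen : ∀ u : T, (2 : ℤ) • u = 0 → ∃ x y : ℤ, u = x • P + y • F P)
    (hfree : ∀ x y : ℤ, x • P + y • F P = 0 → (2 : ℤ) ∣ x ∧ (2 : ℤ) ∣ y)
    {u : T} (hu2 : (2 : ℤ) • u = 0) (huF : F u = u) (hu0 : u ≠ 0) : u = P + F P := by
  obtain ⟨x, y, rfl⟩ := hgen u hu2
  have h2FP : (2 : ℤ) • F P = 0 := by rw [← map_zsmul, h2P, map_zero]
  -- reduce coefficients mod 2
  have hred : ∀ {w : T}, (2 : ℤ) • w = 0 → ∀ n : ℤ, n • w = (n % 2) • w := by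
    intro w hw n
    conv_lhs => rw [← Int.mul_ediv_add_emod n 2]
    rw [add_zsmul, mul_zsmul', hw, zsmul_zero, zero_add]
  have hFu : F (x • P + y • F P) = y • P + x • F P := by
    rw [map_add, map_zsmul, map_zsmul, hFP, add_comm]
  rw [hFu] at huF
  -- `(y - x) P + (x - y) FP = 0` ⟹ `x ≡ y (mod 2)`
  have hrel : (y - x) • P + (x - y) • F P = 0 := by
    have := sub_eq_zero.mpr huF
    rw [sub_smul, sub_smul]
    rw [show y • P + x • F P - (x • P + y • F P) = y • P - x • P + (x • F P - y • F P) by abel] at this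
    exact this
  obtain ⟨hxy, -⟩ := hfree _ _ hrel
  rw [hred h2P x, hred h2FP y]
  have hmod : y % 2 = x % 2 := by
    have := Int.emod_emod_of_dvd (y - x) (dvd_refl (2 : ℤ))
    omega
  rw [hmod]
  rcases Int.emod_two_eq_zero_or_one x with hx | hx
  · exfalso
    apply hu0
    rw [hred h2P x, hred h2FP y, hmod, hx, zero_zsmul, zero_zsmul, add_zero]
  · rw [hx, one_zsmul, one_zsmul]

/-- **The `F`-fixed `2`-power torsion is cyclic** (pairwise comparable): if at most one non-zero
`F`-fixed element of `T` is killed by `2`, then of any two `F`-fixed elements killed by `2^k` one is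
an integer multiple of the other. Reading (with `eq_of_fixed_two_torsion`): at a Kolyvagin prime
of level `≥ M` at `2` on `Δ(E) < 0`, `E(ℚ_ℓ)[2^∞] = Ẽ(𝔽_ℓ)[2^∞]` is CYCLIC (of order
`2^{v₂(ℓ+1−a_ℓ)} ≥ 2^M`), so `E(ℚ_ℓ)/2^M ≅ ℤ/2^M` and McCallum's Lemma 5.3 (i) holds over `ℚ_ℓ`
verbatim. [cite: McCallumLMS1991, §5 Lemma 5.3 ("a duality of cyclic groups of order p^M")] -/
theorem fixed_comparable_of_unique_fixed_involution
    (huniq : ∀ u v : T, (2 : ℤ) • u = 0 → (2 : ℤ) • v = 0 → F u = u → F v = v → u ≠ 0 → v ≠ 0 →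
      u = v) :
    ∀ (k : ℕ) (s t : T), (2 : ℤ) ^ k • s = 0 → (2 : ℤ) ^ k • t = 0 → F s = s → F t = t →
      (∃ n : ℤ, s = n • t) ∨ (∃ n : ℤ, t = n • s) := by
  intro k
  induction k with
  | zero =>
    intro s t hs ht _ _
    rw [pow_zero, one_smul] at hs ht
    exact Or.inl ⟨0, by rw [hs, zero_smul]⟩
  | succ k ih =>
    intro s t hs ht hFs hFt
    -- apply the induction hypothesis to `2s`, `2t`
    have hs2 : (2 : ℤ) ^ k • ((2 : ℤ) • s) = 0 := by rw [smul_smul, ← pow_succ, hs]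
    have ht2 : (2 : ℤ) ^ k • ((2 : ℤ) • t) = 0 := by rw [smul_smul, ← pow_succ, ht]
    have hF2s : F ((2 : ℤ) • s) = (2 : ℤ) • s := by rw [map_zsmul, hFs]
    have hF2t : F ((2 : ℤ) • t) = (2 : ℤ) • t := by rw [map_zsmul, hFt]
    -- symmetric core: if `2s = 2(n t)` then `s` and `t` are comparable
    have core : ∀ (s t : T), (2 : ℤ) ^ (k + 1) • t = 0 → F s = s → F t = t →
        ∀ n : ℤ, (2 : ℤ) • s = n • ((2 : ℤ) • t) →
        (∃ m : ℤ, s = m • t) ∨ (∃ m : ℤ, t = m • s) := by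
      intro s t ht hFs hFt n hn
      -- `u := s - n t` is an `F`-fixed element killed by `2`
      have hu2 : (2 : ℤ) • (s - n • t) = 0 := by
        rw [smul_sub, hn, smul_smul, smul_smul, mul_comm, sub_self]
      have huF : F (s - n • t) = s - n • t := by rw [map_sub, map_zsmul, hFs, hFt]
      by_cases hu0 : s - n • t = 0
      · exact Or.inl ⟨n, sub_eq_zero.mp hu0⟩
      · -- `t ≠ 0` has a bottom element `2^(j-1) t`, which must be `u`
        by_cases ht0 : t = 0
        · exact Or.inr ⟨0, by rw [ht0, zero_smul]⟩
        · have hex : ∃ j : ℕ, (2 : ℤ) ^ j • t = 0 := ⟨k + 1, ht⟩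
          set j := Nat.find hex with hj
          have hjt : (2 : ℤ) ^ j • t = 0 := Nat.find_spec hex
          have hj0 : j ≠ 0 := by
            intro h0
            rw [h0, pow_zero, one_smul] at hjt
            exact ht0 hjt
          have hbot_ne : (2 : ℤ) ^ (j - 1) • t ≠ 0 := by
            have := Nat.find_min hex (show j - 1 < j by omega)
            simpa using this
          have hbot2 : (2 : ℤ) • ((2 : ℤ) ^ (j - 1) • t) = 0 := by
            rw [smul_smul, ← pow_succ', show j - 1 + 1 = j by omega, hjt]
          have hbotF : F ((2 : ℤ) ^ (j - 1) • t) = (2 : ℤ) ^ (j - 1) • t := by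
            rw [map_zsmul, hFt]
          have hub : s - n • t = (2 : ℤ) ^ (j - 1) • t :=
            huniq _ _ hu2 hbot2 huF hbotF hu0 hbot_ne
          refine Or.inl ⟨n + (2 : ℤ) ^ (j - 1), ?_⟩
          rw [add_smul, ← hub, add_sub_cancel]
    rcases ih _ _ hs2 ht2 hF2s hF2t with ⟨n, hn⟩ | ⟨n, hn⟩
    · exact core s t ht hFs hFt n hn
    · rcases core t s hs hFt hFs n hn with h | h
      · exact Or.inr h
      · exact Or.inl h

/-- The anti-fixed version: if at most one non-zero element killed by `2` satisfies `Fu = −u`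
(on `T[2]`, `−u = u`, so this is the same uniqueness), then the `F`-ANTI-fixed `2^k`-torsion is
pairwise comparable — `E^K(ℚ_ℓ)[2^∞] ≅ E(K_λ)[2^∞]^{Frob_ℓ = −1}` is cyclic at every Kolyvagin prime.
[cite: McCallumLMS1991, §5 Lemma 5.3] -/
theorem antifixed_comparable_of_unique_fixed_involution
    (huniq : ∀ u v : T, (2 : ℤ) • u = 0 → (2 : ℤ) • v = 0 → F u = u → F v = v → u ≠ 0 → v ≠ 0 →
      u = v) :
    ∀ (k : ℕ) (s t : T), (2 : ℤ) ^ k • s = 0 → (2 : ℤ) ^ k • t = 0 → F s = -s → F t = -t →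
      (∃ n : ℤ, s = n • t) ∨ (∃ n : ℤ, t = n • s) := by
  -- `-F` is an additive endomorphism with the same fixed involutions
  have huniq' : ∀ u v : T, (2 : ℤ) • u = 0 → (2 : ℤ) • v = 0 → (-F) u = u → (-F) v = v →
      u ≠ 0 → v ≠ 0 → u = v := by
    intro u v hu hv hFu hFv hu0 hv0
    rw [AddMonoidHom.neg_apply, neg_eq_iff_eq_neg] at hFu hFv
    refine huniq u v hu hv ?_ ?_ hu0 hv0
    · rw [hFu, neg_eq_iff_add_eq_zero, ← two_zsmul, hu]
    · rw [hFv, neg_eq_iff_add_eq_zero, ← two_zsmul, hv]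
  intro k s t hs ht hFs hFt
  refine fixed_comparable_of_unique_fixed_involution (-F) huniq' k s t hs ht ?_ ?_
  · rw [AddMonoidHom.neg_apply, hFs, neg_neg]
  · rw [AddMonoidHom.neg_apply, hFt, neg_neg]

end Cyclic

/-! ### §7 McCallum's pairing principle for cyclic groups ("orders multiply past `2^N`")

The workhorse of McCallum's proof of Thm. 5.4 (*"two elements pair nontrivially if … their orders
multiply to more than `p^M`"*) in the form the `ℚ_ℓ`-architecture uses it: `A = ℤP`, `B = ℤQ`
cyclic with `2^N P = 0`, `e : A × B → C` left-non-degenerate; then `e(P, Q)` has order exactly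
`2^N` and **`e(xP, yQ) = 0 ⟺ 2^N ∣ xy`**, i.e. elements of orders `2^i`, `2^j` pair to zero iff
`i + j ≤ N`. Over `ℚ_ℓ` at a Kolyvagin prime (`E(ℚ_ℓ)/2^N` and `H¹(ℚ_ℓ,E)[2^N]` cyclic, §6) this is
exactly Lemma 5.3 (i); over `K_λ` the corresponding statement between NORM LINES is false by one bit
(`Gorenstein.pairing_norm_norm`). -/

section CyclicPairing

variable {A B C : Type*} [AddCommGroup A] [AddCommGroup B] [AddCommGroup C] (e : A →+ B →+ C)
  {N : ℕ} {P : A} {Q : B}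

/-- **The generator pairs to a generator:** if `e` is left-non-degenerate, `2^{N−1}P ≠ 0` and `B = ℤQ`,
then `2^{N−1}·e(P, Q) ≠ 0`. [cite: McCallumLMS1991, §5 Lemma 5.3 ("a duality of cyclic groups of order p^M")] -/
theorem pow_pred_smul_pairing_gen_ne_zero (hperf : ∀ a : A, (∀ b, e a b = 0) → a = 0)
    (hP : (2 : ℤ) ^ (N - 1) • P ≠ 0) (hgenB : ∀ b, ∃ y : ℤ, b = y • Q) :
    (2 : ℤ) ^ (N - 1) • e P Q ≠ 0 := by
  intro h0
  refine hP (hperf _ fun b ↦ ?_)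
  obtain ⟨y, rfl⟩ := hgenB b
  rw [map_zsmul, map_zsmul, AddMonoidHom.zsmul_apply, h0, smul_zero]

/-- **`e(P, Q)` has order exactly `2^N`** (with `2^N P = 0`). [cite: McCallumLMS1991, §5 Lemma 5.3] -/
theorem addOrderOf_pairing_gen (hperf : ∀ a : A, (∀ b, e a b = 0) → a = 0) (hN : 1 ≤ N)
    (hPN : (2 : ℤ) ^ N • P = 0) (hP : (2 : ℤ) ^ (N - 1) • P ≠ 0) (hgenB : ∀ b, ∃ y : ℤ, b = y • Q) :
    addOrderOf (e P Q) = 2 ^ N := by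
  haveI : Fact (Nat.Prime 2) := ⟨Nat.prime_two⟩
  obtain ⟨n, rfl⟩ : ∃ n, N = n + 1 := ⟨N - 1, by omega⟩
  have hne := pow_pred_smul_pairing_gen_ne_zero (N := n + 1) e hperf hP hgenB
  rw [show n + 1 - 1 = n by omega] at hne
  refine addOrderOf_eq_prime_pow (fun h ↦ hne ?_) ?_
  · rw [← natCast_zsmul] at h
    exact_mod_cast h
  · rw [← natCast_zsmul, show ((2 ^ (n + 1) : ℕ) : ℤ) = (2 : ℤ) ^ (n + 1) by push_cast; ring,
      ← AddMonoidHom.zsmul_apply, ← map_zsmul, hPN, map_zero, AddMonoidHom.zero_apply]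

/-- **McCallum's pairing principle, cyclic × cyclic: `e(xP, yQ) = 0 ⟺ 2^N ∣ xy`.** So an element
of order `2^i` of `ℤP` and one of order `2^j` of `ℤQ` pair non-trivially iff `i + j > N` — NO loss,
in contrast with the norm-line × norm-line pairing over `K_λ` (`Gorenstein.pairing_norm_norm`).
[cite: McCallumLMS1991, §5 (proof of Thm. 5.4, "orders multiply to more than p^M")] -/
theorem pairing_zsmul_zsmul_eq_zero_iff (hperf : ∀ a : A, (∀ b, e a b = 0) → a = 0) (hN : 1 ≤ N)
    (hPN : (2 : ℤ) ^ N • P = 0) (hP : (2 : ℤ) ^ (N - 1) • P ≠ 0) (hgenB : ∀ b, ∃ y : ℤ, b = y • Q)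
    (x y : ℤ) : e (x • P) (y • Q) = 0 ↔ (2 : ℤ) ^ N ∣ x * y := by
  rw [map_zsmul, map_zsmul, AddMonoidHom.zsmul_apply, smul_smul, mul_comm,
    ← addOrderOf_dvd_iff_zsmul_eq_zero, addOrderOf_pairing_gen e hperf hN hPN hP hgenB]
  push_cast
  rfl

end CyclicPairing

/-! ### §8 The residual global invariant at `2`: `#X⁺ · #X⁻ = #X · #Ĥ⁰(C₂, X)`

For a FINITE abelian group `X` with an additive involution `τ` (`X = Ш(E/K)[2^∞]`), writing
`X⁺ = ker N′`, `X⁻ = ker N`, `Ĥ⁰ = X⁺/NX`: `#X⁺ · #X⁻ = #X · #Ĥ⁰(C₂, X)`. At odd `p`, `Ĥ⁰ = 0` and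
`X = X⁺ ⊕ X⁻`; at `2` the eigen-architecture (McCallum over `ℚ` for `E` and `E^K`) computes `#X⁺`
and `#X⁻`, and the K-level order `#Ш(E/K)[2^∞]` asked by 22137 differs from their product by the
Kramer-type invariant `#Ĥ⁰(Gal(K/ℚ), Ш(E/K)[2^∞])` — the ONE global `2`-adic quantity the
`p = 2` structure theorem has to control beyond McCallum's bookkeeping (memo Q3-ARCH §0). -/

section Herbrand

open scoped Classical

variable {X : Type*} [AddCommGroup X]

/-- `N′∘N = 0`: the image of `N = 1 + τ` lies in the kernel of `N′ = 1 − τ` (`τ² = 1`). [folklore] -/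
theorem range_norm_le_ker_conorm (τ : X →+ X) (hX : ∀ x, τ (τ x) = x) :
    (AddMonoidHom.id X + τ).range ≤ (AddMonoidHom.id X - τ).ker := by
  rintro _ ⟨x, rfl⟩
  rw [AddMonoidHom.mem_ker]
  simp only [AddMonoidHom.sub_apply, AddMonoidHom.add_apply, AddMonoidHom.id_apply, map_add, hX]
  abel

/-- **`#X⁺ · #X⁻ = #X · #(X⁺/NX)`** for a finite abelian group with involution `τ`
(`X⁺ = ker(1 − τ)`, `X⁻ = ker(1 + τ)`, `NX = range(1 + τ) ≤ X⁺`): the first isomorphism theorem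
`#X = #ker N · #NX` and Lagrange in `X⁺`. Reading: `#Ш(E/K)⁺ · #Ш(E/K)⁻ = #Ш(E/K) · #Ĥ⁰(C₂, Ш(E/K))`.
[cite: McCallumLMS1991, §5 (Ш^{±ε} and the count of Thm. 5.4)] -/
theorem card_fixed_mul_card_antifixed [Finite X] (τ : X →+ X) (hX : ∀ x, τ (τ x) = x) :
    Nat.card (AddMonoidHom.id X - τ).ker * Nat.card (AddMonoidHom.id X + τ).ker =
      Nat.card X * Nat.card ((AddMonoidHom.id X - τ).ker ⧸
        ((AddMonoidHom.id X + τ).range).addSubgroupOf (AddMonoidHom.id X - τ).ker) := by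
  set N := AddMonoidHom.id X + τ with hN
  set N' := AddMonoidHom.id X - τ with hN'
  -- `#X = #ker N · #range N`
  have h1 : Nat.card X = Nat.card N.ker * Nat.card N.range := by
    rw [AddSubgroup.card_eq_card_quotient_mul_card_addSubgroup N.ker, mul_comm,
      Nat.card_congr (QuotientAddGroup.quotientKerEquivRange N).toEquiv]
  -- `#ker N' = #(ker N'/range N) · #range N`
  have hle : N.range ≤ N'.ker := range_norm_le_ker_conorm τ hX
  have h2 : Nat.card N'.ker =
      Nat.card (N'.ker ⧸ (N.range).addSubgroupOf N'.ker) * Nat.card N.range := by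
    rw [AddSubgroup.card_eq_card_quotient_mul_card_addSubgroup ((N.range).addSubgroupOf N'.ker),
      Nat.card_congr (AddSubgroup.addSubgroupOfEquivOfLe hle).toEquiv]
  rw [h1, h2]
  ring

end Herbrand

/-! ### §9 Coinvariants of a free rank-one `R_M`-module: the augmentation (unramified `H¹` over `ℚ_ℓ`)

Over `ℚ_ℓ` at a Kolyvagin prime (`Frob_ℓ = τ` on `E[2^M]`) the unramified classes are
`H¹_ur(ℚ_ℓ, E[2^M]) = E[2^M]/(Frob_ℓ − 1)E[2^M] = A/(τ − 1)A`; for `A = ℤP + ℤτP` free of rank one this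
quotient is `ℤ/2^M` via the AUGMENTATION `xP + yτP ↦ x + y`: `xP + yτP ∈ (1 − τ)A ⟺ 2^M ∣ x + y`. So
`loc_ℓ c = aug [c, ρ]` has any prescribed order — McCallum's Prop. 3.1 / Cor. 3.2 over `ℚ` at `2` with no
index loss (memo Q3-ARCH v2 §0(c)); for the twist `E^K` (`Frob_ℓ = −τ`) the same with `x − y`. -/

section Coinvariants

variable {A : Type*} [AddCommGroup A] (τA : A →+ A) {M : ℕ} {P : A}

/-- **`xP + yτP ∈ (1 − τ)A ⟺ 2^M ∣ x + y`** for `A` free of rank one over `R_M` on `P`: the coinvariants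
`A/(τ − 1)A` are `ℤ/2^M` via the augmentation. [cite: McCallumLMS1991, §3 Prop. 3.1 (φ = φ_{Frob(λ′)})] -/
theorem mem_conorm_range_iff_of_free (hA : ∀ a, τA (τA a) = a) (hPM : (2 : ℤ) ^ M • P = 0)
    (hfree : ∀ x y : ℤ, x • P + y • τA P = 0 → (2 : ℤ) ^ M ∣ x ∧ (2 : ℤ) ^ M ∣ y) (x y : ℤ) :
    (∃ b : A, ∃ u v : ℤ, b = u • P + v • τA P ∧ x • P + y • τA P = b - τA b) ↔ (2 : ℤ) ^ M ∣ x + y := by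
  have hτPM : (2 : ℤ) ^ M • τA P = 0 := by rw [← map_zsmul, hPM, map_zero]
  constructor
  · rintro ⟨b, u, v, rfl, h⟩
    -- `(u - v)P + (v - u)τP = xP + yτP` ⟹ `2^M ∣ x - (u - v)` and `2^M ∣ y - (v - u)`
    have hτb : τA (u • P + v • τA P) = v • P + u • τA P := by
      rw [map_add, map_zsmul, map_zsmul, hA, add_comm]
    rw [hτb] at h
    have hrel : (x - (u - v)) • P + (y - (v - u)) • τA P = 0 := by
      rw [sub_smul, sub_smul, sub_smul, sub_smul]
      rw [show x • P - (u • P - v • P) + (y • τA P - (v • τA P - u • τA P)) =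
        x • P + y • τA P - (u • P + v • τA P - (v • P + u • τA P)) by abel, h, sub_self]
    obtain ⟨⟨k, hk⟩, ⟨k', hk'⟩⟩ := hfree _ _ hrel
    exact ⟨k + k', by linear_combination hk + hk'⟩
  · rintro ⟨k, hk⟩
    refine ⟨x • P, x, 0, by rw [zero_smul, add_zero], ?_⟩
    have hy : y = -x + (2 : ℤ) ^ M * k := by linear_combination hk
    rw [hy, add_smul, mul_comm, mul_smul, hτPM, smul_zero, add_zero, neg_smul, map_zsmul, sub_eq_add_neg]

/-- **`xP + yτP ∈ (1 + τ)A ⟺ 2^M ∣ x − y`**: the coinvariants for the SIGN-twisted involution `−τ`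
(the twist `E^K`, on which `Frob_ℓ` acts as `−τ`) are `ℤ/2^M` via `x − y`. [cite: McCallumLMS1991, §3 Prop. 3.1] -/
theorem mem_norm_range_iff_of_free (hA : ∀ a, τA (τA a) = a) (hPM : (2 : ℤ) ^ M • P = 0)
    (hfree : ∀ x y : ℤ, x • P + y • τA P = 0 → (2 : ℤ) ^ M ∣ x ∧ (2 : ℤ) ^ M ∣ y) (x y : ℤ) :
    (∃ b : A, ∃ u v : ℤ, b = u • P + v • τA P ∧ x • P + y • τA P = b + τA b) ↔ (2 : ℤ) ^ M ∣ x - y := by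
  have hτPM : (2 : ℤ) ^ M • τA P = 0 := by rw [← map_zsmul, hPM, map_zero]
  constructor
  · rintro ⟨b, u, v, rfl, h⟩
    have hτb : τA (u • P + v • τA P) = v • P + u • τA P := by
      rw [map_add, map_zsmul, map_zsmul, hA, add_comm]
    rw [hτb] at h
    have hrel : (x - (u + v)) • P + (y - (v + u)) • τA P = 0 := by
      rw [sub_smul, sub_smul, add_smul, add_smul]
      rw [show x • P - (u • P + v • P) + (y • τA P - (v • τA P + u • τA P)) =
        x • P + y • τA P - (u • P + v • τA P + (v • P + u • τA P)) by abel, h, sub_self]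
    obtain ⟨⟨k, hk⟩, ⟨k', hk'⟩⟩ := hfree _ _ hrel
    exact ⟨k - k', by linear_combination hk - hk'⟩
  · rintro ⟨k, hk⟩
    refine ⟨x • P, x, 0, by rw [zero_smul, add_zero], ?_⟩
    have hy : y = x - (2 : ℤ) ^ M * k := by linear_combination -hk
    rw [hy, sub_smul, mul_comm, mul_smul, hτPM, smul_zero, sub_zero, map_zsmul]

end Coinvariants

end Summit.BirchSwinnertonDyer.BirchSwinnertonDyer.Theorems.GenusExact.Gorenstein
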